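import Summits.ValiantsHypothesis.ValiantsHypothesis.Theses.DivisionGap
import Literature.Computability.AlgebraicComplexity.BirkhoffShadow
import Literature.Computability.AlgebraicComplexity.BirkhoffShadowLowerBound
import Summits.ValiantsHypothesis.ValiantsHypothesis.Theorems.DivisionGapShadowBirkhoffPolytropeDefs
import Summits.ValiantsHypothesis.ValiantsHypothesis.Theorems.DivisionGapShadowBirkhoffStubFaceShadow
import Summits.ValiantsHypothesis.ValiantsHypothesis.Theorems.DivisionGapShadowBirkhoffStubDominoFace
import Summits.ValiantsHypothesis.ValiantsHypothesis.Theorems.DivisionGapShadowBirkhoffStubHeightPolytrope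

/-!
# The planar-dimer engine implies the crux: `PolytropePencil → DivisionGap.ShadowBirkhoff`

Support file for item `stmt-ValiantsHypothesis-5069` (route `DivisionGap`, crux `ShadowBirkhoff`), line
`polytrope-kr-planar-dimers` (leads prover-line-stmt-ValiantsHypothesis-5069-a1-0 / -c1-0).  Three of the four
registered stubs of the line are landed theorems with literally the registered signatures —
`stub_faceShadow` (face transfer, `σ(F_Z) ≤ 4·σ(DS_n)`), `stub_dominoFace` (the `2m × 2m` board is a pattern face
of `DS_n` for `n ≥ 2m²`), `stub_heightPolytrope` (Thurston's height dictionary) — so the whole composition of the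
line is now a closed theorem CONDITIONAL ONLY ON THE ENGINE: `shadowBirkhoff_of_polytropePencil` takes the registered
signature of the one open stub `stub_polytropePencil` as its hypothesis (stated verbatim, no new definition) and
concludes `Summit.ValiantsHypothesis.ValiantsHypothesis.Theses.DivisionGap.ShadowBirkhoff` by name.  In words: if,
for every `c` and all large `m`, some pencil `w₁ + t·w₂` of lattice-point weights on the `2m × 2m` board has more than
`2^((log₂ 2m + c)^c)` height functions that are its unique maximiser at some `t` (super-quasi-polynomially many break
points of a parametric max-weight height function = of a parametric-cost unit-capacity min-cost flow on the planar
cell graph), then the shadow complexity of the Birkhoff polytope is super-quasi-polynomial.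

Proof (all elementary, extracted sorry-free from the registered skeleton
`Cruxes/ShadowBirkhoff/Lines/polytrope_kr_planar_dimers.lean`): a unique maximiser of the pencil at `t` is the strict
maximiser of the exposed functional `y ↦ y 0 + t·y 1` on the planar image of the height functions under
`g ↦ (⟨w₁, g⟩, ⟨w₂, g⟩)`, hence an extreme point of its hull
(`BirkhoffShadowLower.mem_extremePoints_convexHull_of_forall_lt`, HY21 Thm 4 easy half), and distinct maximisers
have distinct images (`exists_heightShadow_ge_uniqueMaximisers`; finiteness of the height functions,
`finite_heightPoints`, from the bound `|g| ≤ 2m`, `abs_le_two_mul_of_mem_heightPoints`); then stubs 3 → 2 → 1 with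
`m = ⌊√(n/2)⌋` and the growth arithmetic `(log₂ n + c)^c + 2 ≤ (log₂ 2m + 2c + 2)^(2c+2)` (`growth_threshold`, from
`n < 8m² < 2^(2·log₂ 2m + 3)`).

References: P. Hrubeš, A. Yehudayoff, *Shadows of Newton polytopes*, CCC 2021, Thm 4 / Open Problem 1
[HrubesYehudayoff2021]; W. P. Thurston, *Conway's tiling groups*, Amer. Math. Monthly 97 (1990) 757–773.
-/

noncomputable section

set_option linter.dupNamespace false

namespace Summit.ValiantsHypothesis.ValiantsHypothesis.Theorems.DivisionGapShadowBirkhoff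

open Literature.Computability.AlgebraicComplexity

/-- Every value of a height function of the `2m × 2m` board is bounded by `2m` in absolute value (indeed by its
column index: zero on column `0`, horizontal increments in `[-1, 1]`). -/
theorem abs_le_two_mul_of_mem_heightPoints {m : ℕ} {g : LatticePt m → ℝ} (hg : g ∈ heightPoints m)
    (p : LatticePt m) : |g p| ≤ 2 * m := by
  obtain ⟨-, hB, -, hH⟩ := hg
  suffices key : ∀ a : ℕ, ∀ ha : a < 2 * m + 1, ∀ b : Fin (2 * m + 1), |g (⟨a, ha⟩, b)| ≤ a by
    obtain ⟨a, b⟩ := p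
    have h1 := key a.1 a.2 b
    have h2 : ((a.1 : ℕ) : ℝ) ≤ 2 * m := by exact_mod_cast Nat.lt_succ_iff.mp a.2
    exact h1.trans h2
  intro a
  induction a with
  | zero =>
    intro ha b
    rw [hB (⟨0, ha⟩, b) (Or.inl rfl), abs_zero]
    simp
  | succ a ih =>
    intro ha b
    have ha' : a < 2 * m := by omega
    have h1 := ih (by omega) b
    have h2 := hH ⟨a, ha'⟩ b
    have e1 : (Fin.succ (⟨a, ha'⟩ : Fin (2 * m))) = (⟨a + 1, ha⟩ : Fin (2 * m + 1)) := rfl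
    have e2 : (Fin.castSucc (⟨a, ha'⟩ : Fin (2 * m))) = (⟨a, by omega⟩ : Fin (2 * m + 1)) := rfl
    simp only [HorizOK, e1, e2] at h2
    rw [abs_le] at h1 ⊢
    push_cast
    split_ifs at h2 with hpar
    · obtain ⟨h2a, h2b⟩ := h2
      constructor <;> linarith [h1.1, h1.2]
    · obtain ⟨h2a, h2b⟩ := h2
      constructor <;> linarith [h1.1, h1.2]

/-- Hence the height functions of the board form a finite set (integer values in `[−2m, 2m]`). -/
theorem finite_heightPoints (m : ℕ) : (heightPoints m).Finite := by
  set T : Set ℝ := (fun z : ℤ => (z : ℝ)) '' Set.Icc (-(2 * m : ℤ)) (2 * m) with hT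
  have hTf : T.Finite := (Set.finite_Icc _ _).image _
  refine (Set.Finite.pi fun _ : LatticePt m => hTf).subset ?_
  intro g hg
  rw [Set.mem_univ_pi]
  intro p
  obtain ⟨z, hz⟩ := hg.1 p
  have hb := abs_le_two_mul_of_mem_heightPoints hg p
  rw [hz] at hb
  refine ⟨z, ?_, hz.symm⟩
  have hb' : |z| ≤ 2 * (m : ℤ) := by exact_mod_cast hb
  exact abs_le.mp hb'

/-- HY21 Thm 4, easy half, in existence form: some planar linear image of the height functions (namely
`g ↦ (⟨w₁, g⟩, ⟨w₂, g⟩)`) has at least as many hull vertices as the pencil `w₁ + t·w₂` has unique maximisers —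
each unique maximiser at `t` is exposed by `y ↦ y 0 + t·y 1`, and distinct ones have distinct images. -/
theorem exists_heightShadow_ge_uniqueMaximisers {m : ℕ} (w : LatticePt m → ℝ × ℝ) :
    ∃ Λ : (LatticePt m → ℝ) →ₗ[ℝ] (Fin 2 → ℝ), (uniqueMaximisers m w).ncard ≤ heightShadowVertexCount Λ := by
  -- the linear map `g ↦ (⟨w₁, g⟩, ⟨w₂, g⟩)`, built without a named definition
  let Λ : (LatticePt m → ℝ) →ₗ[ℝ] (Fin 2 → ℝ) :=
    LinearMap.pi fun i : Fin 2 => ∑ p : LatticePt m, (if i = 0 then (w p).1 else (w p).2) • LinearMap.proj p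
  have hΛ : ∀ (g : LatticePt m → ℝ) (i : Fin 2),
      Λ g i = ∑ p, (if i = 0 then (w p).1 else (w p).2) * g p := by
    intro g i
    simp only [Λ, LinearMap.pi_apply, LinearMap.coe_sum, Finset.sum_apply, LinearMap.smul_apply,
      LinearMap.coe_proj, Function.eval, smul_eq_mul]
  have hval : ∀ (g : LatticePt m → ℝ) (t : ℝ), pencilValue w g t = Λ g 0 + t * Λ g 1 := by
    intro g t
    rw [hΛ, hΛ]
    simp only [pencilValue, if_true, Fin.one_eq_zero_iff, OfNat.ofNat_ne_one, if_false, Finset.mul_sum,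
      ← Finset.sum_add_distrib]
    exact Finset.sum_congr rfl fun p _ => by ring
  refine ⟨Λ, ?_⟩
  have hfin : (Set.extremePoints ℝ (convexHull ℝ (Λ '' heightPoints m))).Finite :=
    ((finite_heightPoints m).image _).subset extremePoints_convexHull_subset
  apply Set.ncard_le_ncard_of_injOn Λ ?_ ?_ hfin
  · rintro g ⟨hg, t, ht⟩
    refine BirkhoffShadowLower.mem_extremePoints_convexHull_of_forall_lt
      (ContinuousLinearMap.proj 0 + t • ContinuousLinearMap.proj 1) ⟨g, hg, rfl⟩ ?_
    rintro s ⟨g', hg', rfl⟩ hne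
    have hne' : g' ≠ g := fun h => hne (by rw [h])
    have := ht g' hg' hne'
    rw [hval, hval] at this
    simpa using this
  · rintro g ⟨hg, t, ht⟩ g' ⟨hg', t', ht'⟩ heq
    by_contra hne
    have h := ht g' hg' (Ne.symm hne)
    rw [hval, hval, heq] at h
    exact lt_irrefl _ h

/-- Growth arithmetic for the composition: with `L = ⌊log₂ n⌋ ≤ 2ℓ + 2`, `ℓ = ⌊log₂ 2m⌋`,
`(L + c)^c + 2 ≤ (ℓ + 2c + 2)^(2c+2)`. -/
theorem growth_threshold (c ℓ L : ℕ) (hL : L ≤ 2 * ℓ + 2) :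
    (L + c) ^ c + 2 ≤ (ℓ + (2 * c + 2)) ^ (2 * c + 2) := by
  have h1 : (L + c) ^ c ≤ 2 ^ c * (ℓ + c + 1) ^ c := by
    calc (L + c) ^ c ≤ (2 * (ℓ + c + 1)) ^ c := Nat.pow_le_pow_left (by omega) c
      _ = 2 ^ c * (ℓ + c + 1) ^ c := by rw [mul_pow]
  have h2 : (ℓ + c + 1) ^ c ≤ (ℓ + (2 * c + 2)) ^ c := Nat.pow_le_pow_left (by omega) c
  have h3 : 4 * 2 ^ c ≤ (ℓ + (2 * c + 2)) ^ (c + 2) := by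
    calc 4 * 2 ^ c = 2 ^ (c + 2) := by ring
      _ ≤ (ℓ + (2 * c + 2)) ^ (c + 2) := Nat.pow_le_pow_left (by omega) _
  have h4 : (ℓ + (2 * c + 2)) ^ (2 * c + 2) =
      (ℓ + (2 * c + 2)) ^ c * (ℓ + (2 * c + 2)) ^ (c + 2) := by
    rw [← pow_add]
    congr 1
    omega
  have h5 : 1 ≤ 2 ^ c * (ℓ + c + 1) ^ c :=
    Nat.one_le_iff_ne_zero.mpr (Nat.mul_ne_zero (pow_ne_zero _ (by norm_num)) (pow_ne_zero _ (by omega)))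
  calc (L + c) ^ c + 2 ≤ 4 * (2 ^ c * (ℓ + c + 1) ^ c) := by omega
    _ = (ℓ + c + 1) ^ c * (4 * 2 ^ c) := by ring
    _ ≤ (ℓ + (2 * c + 2)) ^ c * (4 * 2 ^ c) := Nat.mul_le_mul h2 le_rfl
    _ ≤ (ℓ + (2 * c + 2)) ^ c * (ℓ + (2 * c + 2)) ^ (c + 2) := Nat.mul_le_mul_left _ h3
    _ = (ℓ + (2 * c + 2)) ^ (2 * c + 2) := h4.symm

/-- **The bridge of the line `polytrope-kr-planar-dimers`.**  The registered engine stub (`stub_polytropePencil`,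
stated here verbatim as the hypothesis `hPencil`: super-quasi-polynomially many height functions of the `2m × 2m`
board are unique maximisers along one pencil of lattice-point weights) implies the crux
`DivisionGap.ShadowBirkhoff` (super-quasi-polynomial shadow complexity of the Birkhoff polytope).  Given `c`, run the
engine with `c' = 2c + 2`; for `n ≥ 2(m₀+1)²` take the board of side `2m`, `m = ⌊√(n/2)⌋ ≥ m₀` (so `2m² ≤ n`); unique
maximisers are hull vertices of a planar image of the height functions (`exists_heightShadow_ge_uniqueMaximisers`),
hence of the domino polytope (`stub_heightPolytrope`), of a pattern face of `DS_n` (`stub_dominoFace`), of `DS_n` up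
to the factor `4` (`stub_faceShadow`); and `4 · 2^((log₂ n + c)^c) ≤ 2^((log₂ 2m + c')^c')` by `growth_threshold`
since `n < 8m² < 2^(2 log₂ 2m + 3)`. -/
theorem shadowBirkhoff_of_polytropePencil
    (hPencil : ∀ c : ℕ, ∃ m₀ : ℕ, ∀ m ≥ m₀, ∃ w : LatticePt m → ℝ × ℝ,
      2 ^ ((Nat.log 2 (2 * m) + c) ^ c) < (uniqueMaximisers m w).ncard) :
    Summit.ValiantsHypothesis.ValiantsHypothesis.Theses.DivisionGap.ShadowBirkhoff := by
  show ∀ c : ℕ, ∃ n₀ : ℕ, ∀ n ≥ n₀, ∃ L : (Fin n × Fin n → ℝ) →ₗ[ℝ] (Fin 2 → ℝ),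
      2 ^ ((Nat.log 2 n + c) ^ c) < birkhoffShadowVertexCount L
  intro c
  obtain ⟨m₀, hm₀⟩ := hPencil (2 * c + 2)
  set M : ℕ := (m₀ + 1) * (m₀ + 1) with hM
  refine ⟨2 * M, fun n hn => ?_⟩
  -- the board: side `2m`, `m = ⌊√(n/2)⌋`, so that `DS_{2m²}` pads into `DS_n`
  set m : ℕ := Nat.sqrt (n / 2) with hm_def
  have hmm : m * m ≤ n / 2 := Nat.le_sqrt.1 le_rfl
  have hm₀m : m₀ + 1 ≤ m := Nat.le_sqrt.2 (by omega)
  have hdiv : 2 * (n / 2) ≤ n := Nat.mul_div_le n 2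
  have h2mm : 2 * m * m ≤ n := by
    have : 2 * m * m = 2 * (m * m) := by ring
    omega
  have hm1 : 1 ≤ m := by omega
  obtain ⟨w, hw⟩ := hm₀ m (by omega)
  obtain ⟨Λ, hU⟩ := exists_heightShadow_ge_uniqueMaximisers w
  obtain ⟨L, hL⟩ := stub_heightPolytrope m Λ
  obtain ⟨Z, L', hZ⟩ := stub_dominoFace m n h2mm L
  obtain ⟨L'', hB⟩ := stub_faceShadow n Z L'
  refine ⟨L'', ?_⟩
  -- size arithmetic: `n < 8m² < 2^{2ℓ+3}`, `ℓ = ⌊log₂ (2m)⌋`, hence `⌊log₂ n⌋ ≤ 2ℓ + 2`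
  set ℓ : ℕ := Nat.log 2 (2 * m) with hℓ
  have h2m : 2 * m < 2 ^ (ℓ + 1) := Nat.lt_pow_succ_log_self (by norm_num) (2 * m)
  have hk : n / 2 < (m + 1) * (m + 1) := Nat.lt_succ_sqrt (n / 2)
  have hmsq : (m + 1) * (m + 1) ≤ 4 * (m * m) := by nlinarith [hm1]
  have hn8 : n < 8 * (m * m) := by omega
  have hsq : (2 * m) * (2 * m) < 2 ^ (ℓ + 1) * 2 ^ (ℓ + 1) := Nat.mul_lt_mul'' h2m h2m
  have hpow : 2 ^ (2 * ℓ + 3) = 2 * (2 ^ (ℓ + 1) * 2 ^ (ℓ + 1)) := by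
    rw [← pow_add, ← pow_succ']
    congr 1
    omega
  have he : (2 * m) * (2 * m) = 4 * (m * m) := by ring
  have hnpow : n < 2 ^ (2 * ℓ + 3) := by omega
  have hn0 : n ≠ 0 := by omega
  have hlog : Nat.log 2 n ≤ 2 * ℓ + 2 := Nat.lt_succ_iff.mp (Nat.log_lt_of_lt_pow hn0 hnpow)
  have hE : 2 ^ ((Nat.log 2 n + c) ^ c + 2) ≤ 2 ^ ((ℓ + (2 * c + 2)) ^ (2 * c + 2)) :=
    Nat.pow_le_pow_right (by norm_num) (growth_threshold c ℓ (Nat.log 2 n) hlog)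
  -- the chain: engine hypothesis, then the three landed stubs
  have hchain : 2 ^ ((ℓ + (2 * c + 2)) ^ (2 * c + 2)) < 4 * birkhoffShadowVertexCount L'' :=
    calc 2 ^ ((ℓ + (2 * c + 2)) ^ (2 * c + 2)) < (uniqueMaximisers m w).ncard := hw
      _ ≤ heightShadowVertexCount Λ := hU
      _ ≤ dominoShadowVertexCount L := hL
      _ ≤ patternShadowVertexCount Z L' := hZ
      _ ≤ 4 * birkhoffShadowVertexCount L'' := hB
  have h4x : 4 * 2 ^ ((Nat.log 2 n + c) ^ c) < 4 * birkhoffShadowVertexCount L'' := by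
    have e4 : 2 ^ ((Nat.log 2 n + c) ^ c + 2) = 4 * 2 ^ ((Nat.log 2 n + c) ^ c) := by
      rw [pow_add]; ring
    rw [← e4]
    exact lt_of_le_of_lt hE hchain
  omega

end Summit.ValiantsHypothesis.ValiantsHypothesis.Theorems.DivisionGapShadowBirkhoff

end
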